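import Summits.Ventures.PercRepro.C025ProfileThinRowC
import Summits.Ventures.PercRepro.C025ProfileRowReduction
import Summits.Ventures.PercRepro.C025ProfileThreeFour
import Summits.Ventures.PercRepro.C025ProfileThreeFourHall
import Summits.Ventures.PercRepro.Night2ShadowContract

/-!
# THE ROW `(4, 5)` IN THE THIN REGIME FOR EVERY FINITE MATROID — the class-closed reduction to simple matroids (night-3 g13)
`proofs/NIGHT3-G13-LIFT.md` §4. The tree's `profileIneq_row_of_simple` reduces a row `(q+1, u+1)` to SIMPLE matroids given the row
`(q, u)` for every finite matroid — but its simple-case hypothesis ranges over ALL simple matroids. `profileIneq_row_of_simple_class`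
is the same induction (loop deletion, parallel deletion + the lower row on the contraction) carrying a DELETION-CLOSED class `P`: the
simple case is only needed inside `P`. Thinness «every rank-`q` finset `X ⊆ E` has `≤ q + 1` points» is deletion-closed
(`thin_delete`), and the row `(3, 4)` is a tree theorem for every finite matroid (`profileIneq_three_four`), so THEOREM T(4) holds for
EVERY finite matroid whose rank-`4` sets have at most `5` points: `profileIneq_four_five_of_thin_all` (loops and parallel pairs allowed).
(At `q = 5` the same reduction would need the row `(4, 5)` for every finite matroid, which is not available.)
-/
open scoped Matroid
namespace PercRepro
open Set Finset ThmH Staged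
namespace ThinRow
variable {α : Type} [DecidableEq α]

/-- **One row of `(Π)` reduces to simple matroids inside a deletion-closed class `P`**, given the previous diagonal row on a class
`P'` that contains the contractions `N ／ e` (`e` a non-loop) of the members of `P` (the induction of `profileIneq_row_of_simple`
carrying the classes). -/
theorem profileIneq_row_of_simple_class {q u : ℕ} (hqu : q ≤ u) (P P' : Matroid α → Prop)
    (hP : ∀ (N : Matroid α) [N.Finite] (e : α), P N → P (N ＼ ({e} : Set α)))
    (hPc : ∀ (N : Matroid α) [N.Finite] (e : α), N.IsNonloop e → P N → P' (N ／ ({e} : Set α)))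
    (hS : ∀ (N : Matroid α) [N.Finite], (∀ T ⊆ N.E, T.encard ≤ 2 → N.Indep T) → P N →
      Profile.ProfileIneq N (q + 1) (u + 1))
    (hlow : ∀ (N : Matroid α) [N.Finite], P' N → Profile.ProfileIneq N q u)
    (M : Matroid α) [M.Finite] (hM : P M) : Profile.ProfileIneq M (q + 1) (u + 1) := by
  suffices h : ∀ n : ℕ, ∀ (N : Matroid α) [N.Finite], (gr N).card = n → P N →
      Profile.ProfileIneq N (q + 1) (u + 1) from h _ M rfl hM
  intro n
  induction n using Nat.strong_induction_on with
  | _ n ih =>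
  intro N _ hN hPN
  by_cases hloop : ∃ ℓ, N.IsLoop ℓ
  · obtain ⟨ℓ, hℓ⟩ := hloop
    have hℓE : ℓ ∈ gr N := by rw [← Finset.mem_coe, coe_gr]; exact hℓ.mem_ground
    apply profileIneq_of_delete_isLoop hℓ
    apply ih ((gr N).erase ℓ).card _ (N ＼ ({ℓ} : Set α)) (by rw [gr_delete_singleton'']) (hP N ℓ hPN)
    rw [← hN]; exact Finset.card_erase_lt_of_mem hℓE
  · have hl : ∀ x ∈ N.E, N.IsNonloop x := fun x hx => N.isNonloop_of_not_isLoop hx (fun h => hloop ⟨x, h⟩)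
    by_cases hpar : ∃ e f, f ∈ N.E ∧ f ≠ e ∧ e ∈ N.closure {f}
    · obtain ⟨e, f, hfE, hfe, hef⟩ := hpar
      have heE : e ∈ gr N := by rw [← Finset.mem_coe, coe_gr]; exact N.closure_subset_ground _ hef
      have hlt : ((gr N).erase e).card < n := by rw [← hN]; exact Finset.card_erase_lt_of_mem heE
      apply profileIneq_of_delete_parallel_gen hl hfE hfe hef hqu
      · exact ih _ hlt (N ＼ ({e} : Set α)) (by rw [gr_delete_singleton'']) (hP N e hPN)
      · have heE' : e ∈ N.E := N.closure_subset_ground _ hef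
        exact hlow (N ／ ({e} : Set α)) (hPc N e (hl e heE') hPN)
    · push Not at hpar
      exact hS N (simple_of_no_loop_no_parallel hl hpar) hPN

omit [DecidableEq α] in
/-- Thinness (on finsets of the ground set, stated with `eRk`) is closed under the deletion of a point. -/
theorem thin_delete {q : ℕ} (N : Matroid α) [N.Finite] (e : α)
    (h : ∀ X : Finset α, (X : Set α) ⊆ N.E → N.eRk (X : Set α) = (q : ℕ∞) → X.card ≤ q + 1) :
    ∀ X : Finset α, (X : Set α) ⊆ (N ＼ ({e} : Set α)).E → (N ＼ ({e} : Set α)).eRk (X : Set α) = (q : ℕ∞) →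
      X.card ≤ q + 1 := by
  intro X hX hr
  rw [Matroid.delete_ground] at hX
  have hXg : X ⊆ gr N := by
    intro x hx
    rw [← Finset.mem_coe, coe_gr]
    exact (hX (Finset.mem_coe.mpr hx)).1
  have heX : e ∉ X := by
    intro hx
    exact (hX (Finset.mem_coe.mpr hx)).2 (Set.mem_singleton e)
  rw [eRk_delete_of_notMem hXg heX] at hr
  exact h X (hX.trans Set.sdiff_subset) hr

/-- Thinness at rank `q + 1` of `N` gives thinness at rank `q` of the contraction `N ／ e` of a non-loop `e`: a rank-`q` finset `X` of
`N ／ e` is `(X ∪ {e}) ∖ e` for the rank-`(q+1)` finset `X ∪ {e}` of `N`. -/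
theorem thin_contract {q : ℕ} (N : Matroid α) [N.Finite] (e : α) (he : N.IsNonloop e)
    (h : ∀ X : Finset α, (X : Set α) ⊆ N.E → N.eRk (X : Set α) = ((q + 1 : ℕ) : ℕ∞) → X.card ≤ q + 1 + 1) :
    ∀ X : Finset α, (X : Set α) ⊆ (N ／ ({e} : Set α)).E → (N ／ ({e} : Set α)).eRk (X : Set α) = (q : ℕ∞) →
      X.card ≤ q + 1 := by
  intro X hX hr
  rw [Matroid.contract_ground] at hX
  have heX : e ∉ X := by
    intro hx
    exact (hX (Finset.mem_coe.mpr hx)).2 (Set.mem_singleton e)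
  have h1 := contract_singleton_eRk_add_one he.indep hX
  rw [hr] at h1
  have h2 : N.eRk ((insert e X : Finset α) : Set α) = ((q + 1 : ℕ) : ℕ∞) := by
    rw [Finset.coe_insert, ← h1]; push_cast; rfl
  have h3 : ((insert e X : Finset α) : Set α) ⊆ N.E := by
    rw [Finset.coe_insert]
    exact Set.insert_subset he.mem_ground (hX.trans Set.sdiff_subset)
  have h4 := h _ h3 h2
  rw [Finset.card_insert_of_notMem heX] at h4
  omega

/-- **THEOREM T(4) FOR EVERY FINITE MATROID**: the row `(4, 5)` of (Π) — `5·#{S : ρ(S) = 5} ≥ Σ_{B : ρ(B) = 4, ρ(E∖B) ≥ 5} ρ(E∖B)` —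
holds for every finite matroid in which every rank-`4` subset of the ground set has at most `5` points (loops and parallel
elements allowed). -/
theorem profileIneq_four_five_of_thin_all (M : Matroid α) [M.Finite]
    (hthin : ∀ X : Finset α, (X : Set α) ⊆ M.E → M.eRk (X : Set α) = (4 : ℕ∞) → X.card ≤ 5) :
    Profile.ProfileIneq M 4 5 := by
  refine profileIneq_row_of_simple_class (q := 3) (u := 4) (by omega)
    (fun N => ∀ X : Finset α, (X : Set α) ⊆ N.E → N.eRk (X : Set α) = (4 : ℕ∞) → X.card ≤ 5) (fun _ => True)
    (fun N _ e hN => thin_delete (q := 4) N e hN) (fun _ _ _ _ _ => trivial) ?_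
    (fun N _ _ => profileIneq_three_four N) M hthin
  intro N _ hs hP
  apply profileIneq_four_five_of_thin hs
  intro X hXg hX
  apply hP X
  · rw [← coe_gr]; exact_mod_cast hXg
  · exact rkN_eq_iff.mp hX


/-- **THEOREM T(5) FOR EVERY FINITE MATROID**: the row `(5, 6)` of (Π) holds for every finite matroid in which every rank-`5` subset
of the ground set has at most `6` points — the reduction to simple matroids uses T(4) on the contractions, whose rank-`4` sets are
thin by `thin_contract`. -/
theorem profileIneq_five_six_of_thin_all (M : Matroid α) [M.Finite]
    (hthin : ∀ X : Finset α, (X : Set α) ⊆ M.E → M.eRk (X : Set α) = (5 : ℕ∞) → X.card ≤ 6) :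
    Profile.ProfileIneq M 5 6 := by
  refine profileIneq_row_of_simple_class (q := 4) (u := 5) (by omega)
    (fun N => ∀ X : Finset α, (X : Set α) ⊆ N.E → N.eRk (X : Set α) = (5 : ℕ∞) → X.card ≤ 6)
    (fun N => ∀ X : Finset α, (X : Set α) ⊆ N.E → N.eRk (X : Set α) = (4 : ℕ∞) → X.card ≤ 5)
    (fun N _ e hN => thin_delete (q := 5) N e hN) (fun N _ e he hN => thin_contract (q := 4) N e he hN) ?_
    (fun N _ hN => profileIneq_four_five_of_thin_all N hN) M hthin
  intro N _ hs hP
  apply profileIneq_five_six_of_thin hs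
  intro X hXg hX
  apply hP X
  · rw [← coe_gr]; exact_mod_cast hXg
  · exact rkN_eq_iff.mp hX

/-- **One row of `(H⁺)` reduces to simple matroids inside a deletion-closed class** (the Hall twin of
`profileIneq_row_of_simple_class`). -/
theorem hallIneq_row_of_simple_class {q u : ℕ} (hqu : q ≤ u) (P P' : Matroid α → Prop)
    (hP : ∀ (N : Matroid α) [N.Finite] (e : α), P N → P (N ＼ ({e} : Set α)))
    (hPc : ∀ (N : Matroid α) [N.Finite] (e : α), N.IsNonloop e → P N → P' (N ／ ({e} : Set α)))
    (hS : ∀ (N : Matroid α) [N.Finite], (∀ T ⊆ N.E, T.encard ≤ 2 → N.Indep T) → P N →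
      Profile.HallIneq N (q + 1) (u + 1))
    (hlow : ∀ (N : Matroid α) [N.Finite], P' N → Profile.HallIneq N q u)
    (M : Matroid α) [M.Finite] (hM : P M) : Profile.HallIneq M (q + 1) (u + 1) := by
  suffices h : ∀ n : ℕ, ∀ (N : Matroid α) [N.Finite], (gr N).card = n → P N →
      Profile.HallIneq N (q + 1) (u + 1) from h _ M rfl hM
  intro n
  induction n using Nat.strong_induction_on with
  | _ n ih =>
  intro N _ hN hPN
  by_cases hloop : ∃ ℓ, N.IsLoop ℓ
  · obtain ⟨ℓ, hℓ⟩ := hloop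
    have hℓE : ℓ ∈ gr N := by rw [← Finset.mem_coe, coe_gr]; exact hℓ.mem_ground
    apply hallIneq_of_delete_isLoop hℓ
    apply ih ((gr N).erase ℓ).card _ (N ＼ ({ℓ} : Set α)) (by rw [gr_delete_singleton'']) (hP N ℓ hPN)
    rw [← hN]; exact Finset.card_erase_lt_of_mem hℓE
  · have hl : ∀ x ∈ N.E, N.IsNonloop x := fun x hx => N.isNonloop_of_not_isLoop hx (fun h => hloop ⟨x, h⟩)
    by_cases hpar : ∃ e f, f ∈ N.E ∧ f ≠ e ∧ e ∈ N.closure {f}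
    · obtain ⟨e, f, hfE, hfe, hef⟩ := hpar
      have heE : e ∈ gr N := by rw [← Finset.mem_coe, coe_gr]; exact N.closure_subset_ground _ hef
      have hlt : ((gr N).erase e).card < n := by rw [← hN]; exact Finset.card_erase_lt_of_mem heE
      apply hallIneq_of_delete_parallel_gen hl hfE hfe hef hqu
      · exact ih _ hlt (N ＼ ({e} : Set α)) (by rw [gr_delete_singleton'']) (hP N e hPN)
      · have heE' : e ∈ N.E := N.closure_subset_ground _ hef
        exact hlow (N ／ ({e} : Set α)) (hPc N e (hl e heE') hPN)
    · push Not at hpar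
      exact hS N (simple_of_no_loop_no_parallel hl hpar) hPN

/-- **THEOREM T(4), Hall form, for every finite matroid** whose rank-`4` sets have at most `5` points. -/
theorem hallIneq_four_five_of_thin_all (M : Matroid α) [M.Finite]
    (hthin : ∀ X : Finset α, (X : Set α) ⊆ M.E → M.eRk (X : Set α) = (4 : ℕ∞) → X.card ≤ 5) :
    Profile.HallIneq M 4 5 := by
  refine hallIneq_row_of_simple_class (q := 3) (u := 4) (by omega)
    (fun N => ∀ X : Finset α, (X : Set α) ⊆ N.E → N.eRk (X : Set α) = (4 : ℕ∞) → X.card ≤ 5) (fun _ => True)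
    (fun N _ e hN => thin_delete (q := 4) N e hN) (fun _ _ _ _ _ => trivial) ?_
    (fun N _ _ => hallIneq_three_four N) M hthin
  intro N _ hs hP
  apply hallIneq_four_five_of_thin hs
  intro X hXg hX
  apply hP X
  · rw [← coe_gr]; exact_mod_cast hXg
  · exact rkN_eq_iff.mp hX

/-- **THEOREM T(5), Hall form, for every finite matroid** whose rank-`5` sets have at most `6` points. -/
theorem hallIneq_five_six_of_thin_all (M : Matroid α) [M.Finite]
    (hthin : ∀ X : Finset α, (X : Set α) ⊆ M.E → M.eRk (X : Set α) = (5 : ℕ∞) → X.card ≤ 6) :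
    Profile.HallIneq M 5 6 := by
  refine hallIneq_row_of_simple_class (q := 4) (u := 5) (by omega)
    (fun N => ∀ X : Finset α, (X : Set α) ⊆ N.E → N.eRk (X : Set α) = (5 : ℕ∞) → X.card ≤ 6)
    (fun N => ∀ X : Finset α, (X : Set α) ⊆ N.E → N.eRk (X : Set α) = (4 : ℕ∞) → X.card ≤ 5)
    (fun N _ e hN => thin_delete (q := 5) N e hN) (fun N _ e he hN => thin_contract (q := 4) N e he hN) ?_
    (fun N _ hN => hallIneq_four_five_of_thin_all N hN) M hthin
  intro N _ hs hP
  apply hallIneq_five_six_of_thin hs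
  intro X hXg hX
  apply hP X
  · rw [← coe_gr]; exact_mod_cast hXg
  · exact rkN_eq_iff.mp hX

end ThinRow
end PercRepro
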